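import Summits.QuantumFields.YangMills.Theorems.BalabanUVNodesN21LowCentreEndChartLetter
import Summits.QuantumFields.YangMills.Theorems.BalabanUVNodesN21AnalyticResponseRemainder

/-!
# N21 (NE7c) · CONVEXITY OF THE [LF-II] (1.2) EXPONENT ON THE CHART, IN PRINTED-ROW FORM: the binder
# `hφ : ConvexOn ℝ (K z) (φ z)` of the low-centre ENDs DISCHARGED from (1.9) + the structure of (1.2)'s members + a
# Cauchy letter for the remainder + ONE clause

Width seat pub-ymgap-dag-n21-w3 (g3; director-ym №197 ∕ HUMAN RULING D-0149; dag-lead WIDTH-209 l.28628, N21 piece 2 =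
dag-n21-w1's resume trigger (t4)), node N21 = NE7c (single-run shell-weight bound, NOT PRINTED in [Bałaban 1983–89], NOT
proved), lane K3⁷ `SpineGivenEndpointR13SepCoPH` (stmt-QuantumFields-20544, `--kind proof --supports … --as helper`).
Composes BY NAME dag-n21-w1's ★★★ `N21LowCentreEndSect1Letters.slotAntiConcentration_restrict_of_sect1Letters` (p590709),
★★★★ `N21LowCentreEndChartLetter.slotAntiConcentration_chartLetter_of_sect1Letters` (p592783) and this seat's Cauchy rung
`N21AnalyticResponseRemainder.quadraticRemainder_pi_real_of_differentiableOn_ball` (p585983 ∕ p591155).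

WHY.  On the low-centre road (n21-d parts 30–31 → n21-w1 files 5–12) the (M1) ENDs carry the binder
`hφ : ∀ z, ConvexOn ℝ (K z) (φ z)` — convexity of the (1.2) exponent on the kept chart — as a displayed HYPOTHESIS
(lens v29.0: «`hφ` = a Hessian letter on Bałaban's non-quadratic part, located not typed»).  This file types it in the
letters the ENDs already display.  Print ([LF-II] = [Balaban1989LargeFieldII] (1.2) pp. 356–358, desk ME #33∕#34): the
exponent is `½⟨H_{1,k}B′, Δ₁(ζ₀)H_{1,k}B′⟩ + (1∕g_k)⟨DH_{1,k}B′, ζ₀η⁻²Im ∂U₀⟩ + (1∕g_k²)V(ζ₀, g_kH_{1,k}B′)` — a QUADRATIC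
FORM («the leading quadratic form», (1.7) p. 358) coercive by (1.9), a LINEAR member ((1.5)), and a remainder «at least of
third order in the argument … estimated by O(g_k^{1−β})∣Λ∣» (p. 357), analytic on the complexified chart ([B13 = CMP 116]
Lemma 2 shape: analytic on `{|B| < ε₁g_k⁻¹}` with a value bound).

WHAT.  §1 [textbook]: AFFINE MINORANTS through every point of a convex set ⇒ convex (`convexOn_of_affine_minorant`);
polarisation `y⬝Ay − x⬝Ax − (x⬝A(y−x) + (y−x)⬝Ax) = (y−x)⬝A(y−x)` (`‖w‖² ≤ Σ_b w_b²` is n21-w1's `sq_pi_norm_le_sum_sq`).  §2 ★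
`convexOn_expansion_of_quadraticRemainder`: on a convex `K` with `φ v = c + ½·Qf v + lin v + Vt v`, `Qf v = v ⬝ᵥ (A *ᵥ v)`,
(1.9) `Ineq19 (Qf v) (Σ_b v_b²) γ₀ d M` for every `v`, `lin = ⇑ℓ`, and a QUADRATIC-REMAINDER LETTER `Mq` for `Vt`
(`|Vt y − Vt x − L_x(y − x)| ≤ Mq‖y − x‖²`), `φ` is convex on `K` under the ONE clause `4·d·(100M)^{d+1}·Mq ≤ γ₀`.  §3 ★★
`convexOn_expansion_of_analyticRemainder`: the letter `Mq = 2B∕r²` SUPPLIED by the Cauchy rung from «`Vt = Re ∘ Φ ∘ ι`,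
`Φ` complex differentiable on the `r`-ball about every real point of `K` with oscillation `≤ B`, `diam K < r`»; clause
`8·d·(100M)^{d+1}·B ≤ γ₀·r²` («for g_k sufficiently small»).  §4 ★★★∕★★★★ `…_convexFree`: dag-n21-w1's two ENDs with
`hφ` DISCHARGED by §3 — every other binder verbatim, `h19` asked for every `v` (as printed: (1.9) is a property of the
form).  §5 A6 witness of ★★ on `ℝ¹` with a genuinely third-order analytic remainder `a·w₀³`, every hypothesis discharged.

HONEST FRAMING.  [textbook] convex analysis + the tree's Cauchy rung BY NAME; 0 def, 0 sorry.  The identification of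
(`A`, `ℓ`, `Φ`, `r`, `B`) with the members of [LF-II] (1.2) is LOCATED typing (desk ME #33∕#34, [B13] Lemma 2), NOT asserted;
the convexity of the kept cut `hK` stays displayed (geometric); nothing of Bałaban's asserted; (M1) ∕ NE7c NOT PRINTED ∕
NOT proved; N21 NOT discharged; K3⁷ NOT claimed; counts unmoved (typed 28∕28 · discharged 5∕27); count-neutral; one
finite 𝕋⁴ at fixed ε — the Yang–Mills mass gap (Clay) is NOT proved by any of this: R4 closes the conditional finite-𝕋⁴
rung `BalabanLadder.UV` only; nothing continuum ∕ ℝ⁴ ∕ OS.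
-/

set_option autoImplicit false

open MeasureTheory Set Function Finset Matrix Metric
open scoped ENNReal

namespace Summit.QuantumFields.YangMills.Theorems.N21ChartExponentConvexity

open Literature.MathematicalPhysics.QuantumFieldTheory.Balaban1983to89.T4ShellMeasure (SlotAntiConcentration)
open Literature.MathematicalPhysics.QuantumFieldTheory.Balaban1983to89.B16Sect1Wilson (Ineq16 Ineq19)
open Summit.QuantumFields.YangMills.Theorems.N21LowCentreNumeralBlock (sq_pi_norm_le_sum_sq)
open Summit.QuantumFields.YangMills.Theorems.N21LowCentreEndSect1Letters
  (slotAntiConcentration_restrict_of_sect1Letters)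
open Summit.QuantumFields.YangMills.Theorems.N21LowCentreEndChartLetter
  (slotAntiConcentration_chartLetter_of_sect1Letters)
open Summit.QuantumFields.YangMills.Theorems.N21AnalyticResponseRemainder
  (quadraticRemainder_pi_real_of_differentiableOn_ball)

/-! ## §1  Textbook: affine minorants ⇒ convexity; polarisation -/

section Textbook

variable {V : Type*} [AddCommGroup V] [Module ℝ V]

/-- **AFFINE MINORANTS THROUGH EVERY POINT ⇒ CONVEX.**  If `K` is convex and through every `x ∈ K` there is an additive,
homogeneous `m x` with `f x + m x (y − x) ≤ f y` for all `y ∈ K`, then `f` is convex on `K` (at `z = a•x + b•y` the two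
minorant inequalities from `z` add up, the linear parts cancelling). [textbook] -/
theorem convexOn_of_affine_minorant {K : Set V} (hK : Convex ℝ K) {f : V → ℝ} (m : V → V → ℝ)
    (hm : ∀ z ∈ K, ∀ (u v : V) (a b : ℝ), m z (a • u + b • v) = a * m z u + b * m z v)
    (h : ∀ x ∈ K, ∀ y ∈ K, f x + m x (y - x) ≤ f y) : ConvexOn ℝ K f := by
  refine ⟨hK, fun x hx y hy a b ha hb hab => ?_⟩
  set z := a • x + b • y with hz
  have hzK : z ∈ K := hK hx hy ha hb hab
  have h1 := h z hzK x hx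
  have h2 := h z hzK y hy
  have key : a • (x - z) + b • (y - z) = 0 := by
    have : a • (x - z) + b • (y - z) = (a • x + b • y) - (a + b) • z := by simp only [smul_sub, add_smul]; abel
    rw [this, hab, one_smul, hz, sub_self]
  have hlin : a * m z (x - z) + b * m z (y - z) = 0 := by
    have h0 : m z ((0 : ℝ) • (x - z) + (0 : ℝ) • (y - z)) = 0 := by rw [hm z hzK]; ring
    rw [← hm z hzK, key]
    simpa using h0
  rw [smul_eq_mul, smul_eq_mul]
  have hb' : b = 1 - a := by linarith
  rw [hb'] at hlin ⊢
  nlinarith [mul_le_mul_of_nonneg_left h1 ha, mul_le_mul_of_nonneg_left h2 hb, hlin]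

variable {κ : Type*} [Fintype κ]

/-- **POLARISATION OF A (NOT NECESSARILY SYMMETRIC) QUADRATIC FORM**: `y⬝Ay − x⬝Ax − (x⬝A(y−x) + (y−x)⬝Ax) = (y−x)⬝A(y−x)`. [textbook] -/
theorem quadForm_sub_sub_cross (A : Matrix κ κ ℝ) (x y : κ → ℝ) :
    y ⬝ᵥ (A *ᵥ y) - x ⬝ᵥ (A *ᵥ x) - (x ⬝ᵥ (A *ᵥ (y - x)) + (y - x) ⬝ᵥ (A *ᵥ x)) =
      (y - x) ⬝ᵥ (A *ᵥ (y - x)) := by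
  simp only [mulVec_sub, dotProduct_sub, sub_dotProduct]
  ring

/-- the cross term `w ↦ x⬝Aw + w⬝Ax` is additive and homogeneous. [textbook] -/
theorem cross_linear (A : Matrix κ κ ℝ) (x u v : κ → ℝ) (a b : ℝ) :
    x ⬝ᵥ (A *ᵥ (a • u + b • v)) + (a • u + b • v) ⬝ᵥ (A *ᵥ x) =
      a * (x ⬝ᵥ (A *ᵥ u) + u ⬝ᵥ (A *ᵥ x)) + b * (x ⬝ᵥ (A *ᵥ v) + v ⬝ᵥ (A *ᵥ x)) := by
  simp only [mulVec_add, mulVec_smul, dotProduct_add, add_dotProduct, dotProduct_smul, smul_dotProduct, smul_eq_mul]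
  ring

end Textbook

/-! ## §2  ★ Convexity of the expansion from a quadratic-remainder letter -/

section QuadraticRemainder

variable {κ : Type*} [Fintype κ]

/-- ★ **CONVEXITY OF THE (1.2) EXPONENT FROM (1.9) + STRUCTURE + A QUADRATIC-REMAINDER LETTER + ONE CLAUSE.**  On a
convex `K ⊆ (κ → ℝ)` let `φ v = c + ½·Qf v + lin v + Vt v` (the ENDs' `hexp` letters) with `Qf v = v ⬝ᵥ (A *ᵥ v)` a
quadratic form (print: «the leading quadratic form ⟨H_{1,k}B′, Δ₁(ζ₀)H_{1,k}B′⟩», (1.7) p. 358; no symmetry of `A` needed),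
(1.9) `Ineq19 (Qf v) (Σ_b v_b²) γ₀ d M` for EVERY `v` (a property of the form), `lin = ⇑ℓ` linear (the (1.5) member), and
`Vt` with a quadratic-remainder letter `Mq` on `K`: `|Vt y − Vt x − L_x(y − x)| ≤ Mq·‖y − x‖²`.  Then `φ` is convex on
`K` provided `4·d·(100M)^{d+1}·Mq ≤ γ₀` (i.e. `Mq ≤ ½·γ₀∕(2d(100M)^{d+1})`: the remainder's curvature letter is at most
half the coercivity constant of (1.9)).  Proof: affine minorant `½(x⬝A· + ·⬝Ax) + ℓ + L_x` through `x`; the defect is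
`½(y−x)⬝A(y−x) + [Vt-remainder] ≥ ½λΣ_b(y−x)_b² − Mq‖y−x‖² ≥ 0`. [textbook] -/
theorem convexOn_expansion_of_quadraticRemainder {K : Set (κ → ℝ)} (hK : Convex ℝ K)
    (φ Qf lin Vt : (κ → ℝ) → ℝ) (c : ℝ) (hexp : ∀ v ∈ K, φ v = c + 1 / 2 * Qf v + lin v + Vt v)
    (A : Matrix κ κ ℝ) (hQf : ∀ v, Qf v = v ⬝ᵥ (A *ᵥ v))
    {γ₀ M : ℝ} {d : ℕ} (hd : 1 ≤ d) (hM : 0 < M) (hγ₀ : 0 < γ₀)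
    (h19 : ∀ v, Ineq19 (Qf v) (∑ b, v b ^ 2) γ₀ d M)
    (ℓ : (κ → ℝ) →ₗ[ℝ] ℝ) (hlin : ∀ v, lin v = ℓ v)
    (L : (κ → ℝ) → (κ → ℝ) →ₗ[ℝ] ℝ) {Mq : ℝ}
    (hVt : ∀ x ∈ K, ∀ y ∈ K, |Vt y - Vt x - L x (y - x)| ≤ Mq * ‖y - x‖ ^ 2)
    (hclause : 4 * d * (100 * M) ^ (d + 1) * Mq ≤ γ₀) :
    ConvexOn ℝ K φ := by
  have hd0 : (0 : ℝ) < d := by exact_mod_cast hd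
  set D : ℝ := 2 * d * (100 * M) ^ (d + 1) with hD
  have hDpos : 0 < D := by positivity
  have hlam : 0 < γ₀ / D := div_pos hγ₀ hDpos
  -- the clause: `Mq ≤ ½ · γ₀ / D`
  have hMq : Mq ≤ γ₀ / (2 * D) := by
    rw [le_div_iff₀ (by positivity)]
    calc Mq * (2 * D) = 4 * d * (100 * M) ^ (d + 1) * Mq := by rw [hD]; ring
      _ ≤ γ₀ := hclause
  refine convexOn_of_affine_minorant hK
    (fun x w => 1 / 2 * (x ⬝ᵥ (A *ᵥ w) + w ⬝ᵥ (A *ᵥ x)) + ℓ w + L x w) ?_ ?_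
  · intro z _ u v a b
    rw [cross_linear, map_add, map_smul, map_smul, map_add, map_smul, map_smul]
    simp only [smul_eq_mul]
    ring
  · intro x hx y hy
    have hq : γ₀ / D * ∑ b, (y - x) b ^ 2 ≤ (y - x) ⬝ᵥ (A *ᵥ (y - x)) := by
      have := h19 (y - x)
      unfold Ineq19 at this
      rw [hQf] at this
      simpa [hD] using this
    have hpol := quadForm_sub_sub_cross A x y
    have hrem : -(Mq * ‖y - x‖ ^ 2) ≤ Vt y - Vt x - L x (y - x) := (abs_le.1 (hVt x hx y hy)).1
    have hsq := sq_pi_norm_le_sum_sq (y - x)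
    have hS : 0 ≤ ∑ b, (y - x) b ^ 2 := Finset.sum_nonneg fun b _ => sq_nonneg _
    -- `Mq‖y−x‖² ≤ ½ (γ₀/D) Σ_b (y−x)_b²`
    have hdom : Mq * ‖y - x‖ ^ 2 ≤ γ₀ / (2 * D) * ∑ b, (y - x) b ^ 2 := by
      rcases le_or_gt Mq 0 with hneg | hpos
      · calc Mq * ‖y - x‖ ^ 2 ≤ 0 := mul_nonpos_of_nonpos_of_nonneg hneg (sq_nonneg _)
          _ ≤ γ₀ / (2 * D) * ∑ b, (y - x) b ^ 2 := mul_nonneg (by positivity) hS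
      · calc Mq * ‖y - x‖ ^ 2 ≤ Mq * ∑ b, (y - x) b ^ 2 := mul_le_mul_of_nonneg_left hsq hpos.le
          _ ≤ γ₀ / (2 * D) * ∑ b, (y - x) b ^ 2 := mul_le_mul_of_nonneg_right hMq hS
    have hhalf : γ₀ / (2 * D) * ∑ b, (y - x) b ^ 2 = 1 / 2 * (γ₀ / D * ∑ b, (y - x) b ^ 2) := by
      field_simp
    rw [hexp x hx, hexp y hy, hQf x, hQf y, hlin x, hlin y, map_sub]
    nlinarith [hq, hpol, hrem, hdom, hhalf]

end QuadraticRemainder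

/-! ## §3  ★★ The letter supplied by the Cauchy rung: analytic remainder with an oscillation bound -/

section AnalyticRemainder

variable {κ : Type*} [Fintype κ]

/-- **THE QUADRATIC-REMAINDER LETTER OF AN ANALYTIC REMAINDER** (Cauchy rung, this seat's p591155 §3 BY NAME, `E = ℂ`,
real part): if `Vt = Re ∘ Φ ∘ ι` on `K` for a complex `Φ : (κ → ℂ) → ℂ` complex differentiable on the `r`-ball (sup
norm) about every real point `ι x`, `x ∈ K`, with oscillation `Φ(ball) ⊆ closedBall (Φ(ι x)) B`, and `diam K < r`, then
`|Vt y − Vt x − L_x(y − x)| ≤ (2B∕r²)‖y − x‖²` on `K` for real-linear `L_x` (`= Re ∘ DΦ(ι x) ∘ ι`).  [B13 = CMP 116]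
Lemma 2 shape (analytic on `{|B| < ε₁g_k⁻¹}` with the value bound (1.36)); letters LOCATED, not asserted. [textbook] -/
theorem quadraticRemainderLetter_of_analyticRemainder (Vt : (κ → ℝ) → ℝ) (Φ : (κ → ℂ) → ℂ) {K : Set (κ → ℝ)}
    {r B : ℝ} (hVt : ∀ x ∈ K, Vt x = (Φ fun i => (x i : ℂ)).re)
    (hΦd : ∀ x ∈ K, DifferentiableOn ℂ Φ (ball (fun i => (x i : ℂ)) r))
    (hΦB : ∀ x ∈ K, MapsTo Φ (ball (fun i => (x i : ℂ)) r) (closedBall (Φ fun i => (x i : ℂ)) B))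
    (hdiam : ∀ x ∈ K, ∀ y ∈ K, ‖y - x‖ < r) :
    ∃ L : (κ → ℝ) → (κ → ℝ) →ₗ[ℝ] ℝ, ∀ x ∈ K, ∀ y ∈ K,
      |Vt y - Vt x - L x (y - x)| ≤ 2 * B / r ^ 2 * ‖y - x‖ ^ 2 := by
  obtain ⟨Lc, hLc⟩ := quadraticRemainder_pi_real_of_differentiableOn_ball Φ hΦd hΦB hdiam
  refine ⟨fun x => Complex.reLm.comp (Lc x), fun x hx y hy => ?_⟩
  have h := hLc x hx y hy
  have hre : Vt y - Vt x - (Complex.reLm.comp (Lc x)) (y - x) =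
      (Φ (fun i => (y i : ℂ)) - Φ (fun i => (x i : ℂ)) - Lc x (y - x)).re := by
    rw [hVt x hx, hVt y hy, LinearMap.comp_apply, Complex.reLm_coe, Complex.sub_re, Complex.sub_re]
  rw [hre]
  exact (Complex.abs_re_le_norm _).trans h

/-- ★★ **CONVEXITY OF THE (1.2) EXPONENT WITH AN ANALYTIC REMAINDER** = ★ with the letter `Mq = 2B∕r²` SUPPLIED by the
Cauchy rung: structure of the members + (1.9) for every `v` + «`Vt = Re Φ∘ι`, `Φ` complex differentiable on the `r`-balls
about the real points of `K` with oscillation `≤ B`, `diam K < r`» ⇒ `ConvexOn ℝ K φ` under the ONE clause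
`8·d·(100M)^{d+1}·B ≤ γ₀·r²` (print: `B = O(g_k^{1−β})∣Λ∣` on the chart `|B′| < M₀g_k⁻¹ε_k` — «for g_k sufficiently
small»; LOCATED, not asserted). [textbook] -/
theorem convexOn_expansion_of_analyticRemainder {K : Set (κ → ℝ)} (hK : Convex ℝ K)
    (φ Qf lin Vt : (κ → ℝ) → ℝ) (c : ℝ) (hexp : ∀ v ∈ K, φ v = c + 1 / 2 * Qf v + lin v + Vt v)
    (A : Matrix κ κ ℝ) (hQf : ∀ v, Qf v = v ⬝ᵥ (A *ᵥ v))
    {γ₀ M : ℝ} {d : ℕ} (hd : 1 ≤ d) (hM : 0 < M) (hγ₀ : 0 < γ₀)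
    (h19 : ∀ v, Ineq19 (Qf v) (∑ b, v b ^ 2) γ₀ d M)
    (ℓ : (κ → ℝ) →ₗ[ℝ] ℝ) (hlin : ∀ v, lin v = ℓ v)
    (Φ : (κ → ℂ) → ℂ) {r B : ℝ} (hVt : ∀ x ∈ K, Vt x = (Φ fun i => (x i : ℂ)).re)
    (hΦd : ∀ x ∈ K, DifferentiableOn ℂ Φ (ball (fun i => (x i : ℂ)) r))
    (hΦB : ∀ x ∈ K, MapsTo Φ (ball (fun i => (x i : ℂ)) r) (closedBall (Φ fun i => (x i : ℂ)) B))
    (hdiam : ∀ x ∈ K, ∀ y ∈ K, ‖y - x‖ < r)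
    (hclause : 8 * d * (100 * M) ^ (d + 1) * B ≤ γ₀ * r ^ 2) :
    ConvexOn ℝ K φ := by
  obtain ⟨L, hL⟩ := quadraticRemainderLetter_of_analyticRemainder Vt Φ hVt hΦd hΦB hdiam
  refine convexOn_expansion_of_quadraticRemainder hK φ Qf lin Vt c hexp A hQf hd hM hγ₀ h19 ℓ hlin L hL ?_
  -- the clause at `Mq = 2B∕r²`
  rcases eq_or_ne r 0 with hr | hr
  · subst hr
    simp only [ne_eq, OfNat.ofNat_ne_zero, not_false_eq_true, zero_pow, div_zero, mul_zero]
    exact hγ₀.le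
  · have hr2 : 0 < r ^ 2 := by positivity
    rw [show 4 * (d : ℝ) * (100 * M) ^ (d + 1) * (2 * B / r ^ 2) = 8 * d * (100 * M) ^ (d + 1) * B / r ^ 2 by ring,
      div_le_iff₀ hr2]
    exact hclause

end AnalyticRemainder

/-! ## §4  ★★★∕★★★★ dag-n21-w1's ENDs with `hφ` DISCHARGED -/

section Ends

variable {X : Type*} [MeasurableSpace X] {κ : Type*} [Fintype κ]

/-- ★★★ **(M1) ON THE CUT LAW ABOUT THE BACKGROUND AT [LF-II] §1's LETTERS — CONVEXITY BINDER DISCHARGED.**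
dag-n21-w1's ★★★ `slotAntiConcentration_restrict_of_sect1Letters` (p590709) with `hφ : ∀ z, ConvexOn ℝ (K z) (φ z)`
REPLACED by: the quadratic member is a form `Qf z v = v ⬝ᵥ (A z *ᵥ v)`, (1.9) holds for every `v`, the linear member
is `⇑(ℓ z)`, the remainder is `Re Φ_z∘ι` with `Φ_z` complex differentiable on the `r`-balls about the real points of `K z`
with oscillation `≤ B`, `diam K z < r`, and the clause `8·d·(100M)^{d+1}·B ≤ γ₀·r²`.  Every other binder verbatim.
[textbook] -/
theorem slotAntiConcentration_restrict_of_sect1Letters_convexFree [Nonempty κ] (ζ : Measure X) [SFinite ζ]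
    (K : X → Set (κ → ℝ)) (φ Qf lin Vt : X → (κ → ℝ) → ℝ)
    (hg : Measurable fun p : X × (κ → ℝ) =>
      (K p.1).indicator (fun w => ENNReal.ofReal (Real.exp (-φ p.1 w))) p.2)
    {U : X × (κ → ℝ) → ℝ} (hUm : Measurable U)
    {C Env : Set (X × (κ → ℝ))} (hC : MeasurableSet C) (hEnv : MeasurableSet Env)
    {θ ρ σ κ₀ Q L γ₀ M B₃ M₀ A₀ p₀g Rk WV : ℝ} {d : ℕ}
    (hθ : 0 < θ) (hρ0 : 0 < ρ) (hρ1 : ρ < 1) (hρσ : ρ + σ ≤ 1) (hκ : 0 < κ₀) (hQ0 : 0 ≤ Q) (hL : 0 < L)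
    (hd : 1 ≤ d) (hM : 0 < M) (hγ₀ : 0 < γ₀)
    (hW : 0 ≤ 3 * B₃ * M₀ * A₀ ^ 2 * p₀g ^ 2 * Real.exp (-Rk) * (100 * M) ^ 4 + WV)
    (hK : ∀ z, Convex ℝ (K z)) (h0K : ∀ z, (0 : κ → ℝ) ∈ K z)
    (hexp : ∀ z, ∀ v ∈ K z, φ z v = φ z 0 + 1 / 2 * Qf z v + lin z v + Vt z v)
    (A : X → Matrix κ κ ℝ) (hQf : ∀ z v, Qf z v = v ⬝ᵥ (A z *ᵥ v))
    (h19 : ∀ z v, Ineq19 (Qf z v) (∑ b, v b ^ 2) γ₀ d M)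
    (h16 : ∀ z, ∀ v ∈ K z, Ineq16 (lin z v) B₃ M₀ A₀ p₀g Rk M)
    (ℓ : X → (κ → ℝ) →ₗ[ℝ] ℝ) (hlin : ∀ z v, lin z v = ℓ z v)
    (hV : ∀ z, ∀ v ∈ K z, |Vt z v| ≤ WV)
    (Φ : X → (κ → ℂ) → ℂ) {r B : ℝ} (hVtΦ : ∀ z, ∀ x ∈ K z, Vt z x = (Φ z fun i => (x i : ℂ)).re)
    (hΦd : ∀ z, ∀ x ∈ K z, DifferentiableOn ℂ (Φ z) (ball (fun i => (x i : ℂ)) r))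
    (hΦB : ∀ z, ∀ x ∈ K z, MapsTo (Φ z) (ball (fun i => (x i : ℂ)) r) (closedBall (Φ z fun i => (x i : ℂ)) B))
    (hdiam : ∀ z, ∀ x ∈ K z, ∀ y ∈ K z, ‖y - x‖ < r)
    (hconv : 8 * d * (100 * M) ^ (d + 1) * B ≤ γ₀ * r ^ 2)
    (hU : ∀ z (a b : κ → ℝ), U (z, a) - U (z, b) ≤ L * ‖a - b‖)
    (hUc : ∀ z, U (z, 0) ≤ σ * θ)
    (hclause : 16 * (3 * B₃ * M₀ * A₀ ^ 2 * p₀g ^ 2 * Real.exp (-Rk) * (100 * M) ^ 4 + WV) * d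
      * (100 * M) ^ (d + 1) * L ^ 2 ≤ γ₀ * (θ * (1 - ρ - σ)) ^ 2)
    (henv : ∀ l ∈ Icc (1 - 1 / ((Fintype.card κ : ℝ) + 1)) 1, ∀ p : X × (κ → ℝ),
      θ * (1 - ρ) ≤ U p → U p < θ → p ∈ C → (p.1, (0 : κ → ℝ) + l • (p.2 - 0)) ∈ Env)
    (hRT : ∀ p : X × (κ → ℝ), θ * (1 - ρ) ≤ U p → U p < θ → p ∈ C → ∀ s : ℝ, 1 ≤ s →
      θ * (1 - ρ) ≤ U (p.1, (0 : κ → ℝ) + s • (p.2 - 0)) → U (p.1, (0 : κ → ℝ) + s • (p.2 - 0)) < θ →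
        (p.1, (0 : κ → ℝ) + s • (p.2 - 0)) ∈ C →
          U p + κ₀ * (θ * (1 - ρ)) * (s - 1) ≤ U (p.1, (0 : κ → ℝ) + s • (p.2 - 0)))
    (hQ : ((ζ.prod volume).withDensity fun p : X × (κ → ℝ) =>
        (K p.1).indicator (fun w => ENNReal.ofReal (Real.exp (-φ p.1 w))) p.2) (Env \ ({p | U p < θ} ∩ C))
      ≤ ENNReal.ofReal Q * ((ζ.prod volume).withDensity fun p : X × (κ → ℝ) =>
        (K p.1).indicator (fun w => ENNReal.ofReal (Real.exp (-φ p.1 w))) p.2) ({p | U p < θ} ∩ C)) :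
    SlotAntiConcentration
      ((((ζ.prod volume).withDensity fun p : X × (κ → ℝ) =>
          (K p.1).indicator (fun w => ENNReal.ofReal (Real.exp (-φ p.1 w))) p.2)).restrict ({p | U p < θ} ∩ C))
      U θ ρ (3 * ((Fintype.card κ : ℝ) + 1) * (1 + Q) / (κ₀ * (1 - ρ))) :=
  slotAntiConcentration_restrict_of_sect1Letters ζ K φ Qf lin Vt hg hUm hC hEnv hθ hρ0 hρ1 hρσ hκ hQ0 hL hd hM hγ₀
    hW hK
    (fun z => convexOn_expansion_of_analyticRemainder (hK z) (φ z) (Qf z) (lin z) (Vt z) (φ z 0) (hexp z) (A z)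
      (hQf z) hd hM hγ₀ (h19 z) (ℓ z) (hlin z) (Φ z) (hVtΦ z) (hΦd z) (hΦB z) (hdiam z) hconv)
    h0K hexp (fun z v _ => h19 z v) h16 hV hU hUc hclause henv hRT hQ

/-- ★★★★ **(M1) FOR THE BLOCK's OWN SUP-NORM LETTER UNDER THE (1.2) BLOCK LAW — CONVEXITY BINDER DISCHARGED.**
dag-n21-w1's ★★★★ `slotAntiConcentration_chartLetter_of_sect1Letters` (p592783: statistic `‖B′‖`, cut `univ`, envelope
`{‖B′‖ < θ}`, every geometric binder already a theorem) with `hφ` REPLACED as in ★★★.  What that species displays after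
this file: kept CONVEX cuts `K z ∋ 0` of sup-diameter `< r`, the structure of (1.2)'s members (`A z`, `ℓ z`, `Φ z`), the
PRINTED ROWS (1.9) (every `v`) ∕ (1.6) (on `K z`), the remainder's value bound `W_V` and Cauchy letters (`r`, `B`), and
TWO clauses: `16·W·d·(100M)^{d+1} ≤ γ₀(θ(1−ρ))²` and `8·d·(100M)^{d+1}·B ≤ γ₀·r²`. [textbook] -/
theorem slotAntiConcentration_chartLetter_of_sect1Letters_convexFree [Nonempty κ] (ζ : Measure X) [SFinite ζ]
    (K : X → Set (κ → ℝ)) (φ Qf lin Vt : X → (κ → ℝ) → ℝ)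
    (hg : Measurable fun p : X × (κ → ℝ) =>
      (K p.1).indicator (fun w => ENNReal.ofReal (Real.exp (-φ p.1 w))) p.2)
    {θ ρ γ₀ M B₃ M₀ A₀ p₀g Rk WV : ℝ} {d : ℕ}
    (hθ : 0 < θ) (hρ0 : 0 < ρ) (hρ1 : ρ < 1) (hd : 1 ≤ d) (hM : 0 < M) (hγ₀ : 0 < γ₀)
    (hW : 0 ≤ 3 * B₃ * M₀ * A₀ ^ 2 * p₀g ^ 2 * Real.exp (-Rk) * (100 * M) ^ 4 + WV)
    (hK : ∀ z, Convex ℝ (K z)) (h0K : ∀ z, (0 : κ → ℝ) ∈ K z)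
    (hexp : ∀ z, ∀ v ∈ K z, φ z v = φ z 0 + 1 / 2 * Qf z v + lin z v + Vt z v)
    (A : X → Matrix κ κ ℝ) (hQf : ∀ z v, Qf z v = v ⬝ᵥ (A z *ᵥ v))
    (h19 : ∀ z v, Ineq19 (Qf z v) (∑ b, v b ^ 2) γ₀ d M)
    (h16 : ∀ z, ∀ v ∈ K z, Ineq16 (lin z v) B₃ M₀ A₀ p₀g Rk M)
    (ℓ : X → (κ → ℝ) →ₗ[ℝ] ℝ) (hlin : ∀ z v, lin z v = ℓ z v)
    (hV : ∀ z, ∀ v ∈ K z, |Vt z v| ≤ WV)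
    (Φ : X → (κ → ℂ) → ℂ) {r B : ℝ} (hVtΦ : ∀ z, ∀ x ∈ K z, Vt z x = (Φ z fun i => (x i : ℂ)).re)
    (hΦd : ∀ z, ∀ x ∈ K z, DifferentiableOn ℂ (Φ z) (ball (fun i => (x i : ℂ)) r))
    (hΦB : ∀ z, ∀ x ∈ K z, MapsTo (Φ z) (ball (fun i => (x i : ℂ)) r) (closedBall (Φ z fun i => (x i : ℂ)) B))
    (hdiam : ∀ z, ∀ x ∈ K z, ∀ y ∈ K z, ‖y - x‖ < r)
    (hconv : 8 * d * (100 * M) ^ (d + 1) * B ≤ γ₀ * r ^ 2)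
    (hclause : 16 * (3 * B₃ * M₀ * A₀ ^ 2 * p₀g ^ 2 * Real.exp (-Rk) * (100 * M) ^ 4 + WV) * d
      * (100 * M) ^ (d + 1) ≤ γ₀ * (θ * (1 - ρ)) ^ 2) :
    SlotAntiConcentration
      ((((ζ.prod volume).withDensity fun p : X × (κ → ℝ) =>
          (K p.1).indicator (fun w => ENNReal.ofReal (Real.exp (-φ p.1 w))) p.2)).restrict
        ({p : X × (κ → ℝ) | ‖p.2‖ < θ} ∩ univ))
      (fun p : X × (κ → ℝ) => ‖p.2‖) θ ρ (3 * ((Fintype.card κ : ℝ) + 1) * (1 + 0) / (1 * (1 - ρ))) :=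
  slotAntiConcentration_chartLetter_of_sect1Letters ζ K φ Qf lin Vt hg hθ hρ0 hρ1 hd hM hγ₀ hW hK
    (fun z => convexOn_expansion_of_analyticRemainder (hK z) (φ z) (Qf z) (lin z) (Vt z) (φ z 0) (hexp z) (A z)
      (hQf z) hd hM hγ₀ (h19 z) (ℓ z) (hlin z) (Φ z) (hVtΦ z) (hΦd z) (hΦB z) (hdiam z) hconv)
    h0K hexp (fun z v _ => h19 z v) h16 hV hclause

end Ends

/-! ## §5  A6 witness: ★★ with every hypothesis discharged in the kernel (a third-order analytic remainder) -/

section Witness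
/-- **A6 WITNESS OF ★★** (director-ym STANDING A6 RULE №189 (3)): block `ℝ¹`, kept cut `K = closedBall 0 1` (sup
diameter `≤ 2 < r = 3`), `φ w = ½w₀² + a·w₀³` with `c = 0`, `Qf w = w₀² = w ⬝ᵥ (1 *ᵥ w)`, (1.9) at `γ₀ = 1`, `d = 1`,
`M = 1∕100` (`½Σ_b w_b² ≤ w₀²`), `lin = 0 = ⇑0`, remainder `Vt w = a·w₀³ = Re (a·u₀³)∘ι` — genuinely THIRD ORDER, as print
says of `V` — with `Φ u = a·u₀³` entire and of oscillation `≤ 65|a|` on the `3`-balls about the real points of `K`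
(`|u₀| < 4` there), at `a = 10⁻⁴`: the clause `8·1·1·(65·10⁻⁴) ≤ 1·3²`.  Conclusion: `½w₀² + 10⁻⁴w₀³` is convex on
`[−1, 1]` — a satisfiability witness, not an estimate on Bałaban's action. [textbook] -/
theorem chartExponentConvexity_letters_inhabited :
    ConvexOn ℝ (closedBall (0 : Fin 1 → ℝ) 1)
      (fun w : Fin 1 → ℝ => 1 / 2 * w 0 ^ 2 + (1 / 10000 : ℝ) * w 0 ^ 3) := by
  have hdot : ∀ v : Fin 1 → ℝ, v 0 ^ 2 = v ⬝ᵥ ((1 : Matrix (Fin 1) (Fin 1) ℝ) *ᵥ v) := by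
    intro v
    rw [one_mulVec, dotProduct, Fin.sum_univ_one, sq]
  refine convexOn_expansion_of_analyticRemainder (convex_closedBall _ _)
    (fun w => 1 / 2 * w 0 ^ 2 + (1 / 10000 : ℝ) * w 0 ^ 3) (fun w => w 0 ^ 2) (fun _ => 0)
    (fun w => (1 / 10000 : ℝ) * w 0 ^ 3) 0 ?_ 1 hdot (γ₀ := 1) (M := 1 / 100) (d := 1) le_rfl (by norm_num)
    one_pos ?_ 0 (fun _ => rfl) (fun u => (1 / 10000 : ℂ) * u 0 ^ 3) (r := 3) (B := 65 / 10000) ?_ ?_ ?_ ?_ ?_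
  · intro v _; ring  -- the expansion identity
  · -- (1.9) at γ₀ = 1, d = 1, M = 1/100: ½ Σ_b v_b² ≤ v₀²
    intro v
    unfold Ineq19
    simp only [Fin.sum_univ_one, Nat.cast_one]
    nlinarith [sq_nonneg (v 0)]
  · -- `Vt = Re Φ∘ι`
    intro x _
    simp only [← Complex.ofReal_pow, ← Complex.ofReal_ofNat, ← Complex.ofReal_one, ← Complex.ofReal_div,
      ← Complex.ofReal_mul, Complex.ofReal_re]
  · -- `Φ` entire
    intro x _
    exact ((differentiable_const _).mul ((differentiable_apply (0 : Fin 1)).pow 3)).differentiableOn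
  · -- oscillation ≤ 65·10⁻⁴ on the 3-ball about a real point of K
    intro x hx u hu
    rw [mem_closedBall, dist_zero_right] at hx; rw [mem_ball, dist_eq_norm] at hu; rw [mem_closedBall, dist_eq_norm]
    have hx0 : |x 0| ≤ 1 := (norm_le_pi_norm x 0).trans hx
    have hu0 : ‖u 0 - (x 0 : ℂ)‖ < 3 := lt_of_le_of_lt (norm_le_pi_norm (u - fun i => (x i : ℂ)) 0) hu
    have hu4 : ‖u 0‖ ≤ 4 := by
      have : ‖u 0‖ ≤ ‖u 0 - (x 0 : ℂ)‖ + ‖(x 0 : ℂ)‖ := norm_le_norm_sub_add _ _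
      rw [Complex.norm_real, Real.norm_eq_abs] at this
      linarith
    have hx1 : ‖(x 0 : ℂ)‖ ≤ 1 := by rw [Complex.norm_real, Real.norm_eq_abs]; exact hx0
    calc ‖(1 / 10000 : ℂ) * u 0 ^ 3 - (1 / 10000 : ℂ) * (x 0 : ℂ) ^ 3‖
        = ‖(1 / 10000 : ℂ)‖ * ‖u 0 ^ 3 - (x 0 : ℂ) ^ 3‖ := by rw [← mul_sub, norm_mul]
      _ ≤ 1 / 10000 * (‖u 0‖ ^ 3 + ‖(x 0 : ℂ)‖ ^ 3) := by
          have h1 : ‖(1 / 10000 : ℂ)‖ = 1 / 10000 := by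
            rw [show (1 / 10000 : ℂ) = ((1 / 10000 : ℝ) : ℂ) by push_cast; ring, Complex.norm_real,
              Real.norm_eq_abs, abs_of_pos (by norm_num)]
          rw [h1]
          refine mul_le_mul_of_nonneg_left ((norm_sub_le _ _).trans ?_) (by norm_num)
          rw [norm_pow, norm_pow]
      _ ≤ 1 / 10000 * (4 ^ 3 + 1 ^ 3) := by gcongr
      _ = 65 / 10000 := by norm_num
  · -- sup diameter of K ≤ 2 < 3
    intro x hx y hy
    rw [mem_closedBall, dist_zero_right] at hx hy
    calc ‖y - x‖ ≤ ‖y‖ + ‖x‖ := norm_sub_le _ _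
      _ < 3 := by linarith
  · norm_num  -- the clause 8·1·1²·(65/10000) ≤ 1·3²

end Witness

end Summit.QuantumFields.YangMills.Theorems.N21ChartExponentConvexity
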